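import Summits.CriticalPhenomena.PercolationContinuityZ3.Theorems.PercNearOneGluingNoHeavyLowerTailApexTwoSumTools
import Summits.CriticalPhenomena.PercolationContinuityZ3.Theorems.PercNearOneGluingNoHeavyLowerTailApexTwoSumPendant
import HarnessLib

/-!
# `NoHeavyLowerTail` (stmt-CriticalPhenomena-4575) — 2-sums through the apex, part 8:
# R1-RC ON FANS for every `q ≥ 1` (kernel; first use of the 2-sum theorem)

Support file (prover prim-gen-kcluster gen 72; `--supports stmt-CriticalPhenomena-4575`).  No definitions, no named
facts, no sorries.

THE FAN over a list `l = [v₁, …, v_L]` of distinct vertices with apex `a ∉ l` is the weighted graph with support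
`F(a; l) = {a v_i : 1 ≤ i ≤ L} ∪ {v_i v_{i+1} : 1 ≤ i < L}` (all spokes and the rim path; written inline as
`(l.map (s(a,·)) ++ zipWith s(·,·) l l.tail).toFinset`, no definition is introduced).

**THEOREM** (`ApexTwoSum.fan_r1`).  For every `q ≥ 1`, every list `x :: (l ++ [z])` of distinct vertices avoiding `a`, and
every parameter vector `w` that is positive on `F(a; x :: (l ++ [z]))` and vanishes off it, the free random-cluster measure
`rcMeasureW w q ∅` satisfies R1 for the instance `(a; x, z)` (apex = the hub, terminals = the two ends of the rim path):
`φ(x, z ∈ C(a)) · φ(x, z ∉ C(a), C(a) meets every x–z path) ≤ φ(x ∈ C(a), z ∉ C(a)) · φ(z ∈ C(a), x ∉ C(a))`.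

PROOF: induction on the rim.  Two rim vertices: the terminals are adjacent (`r1_of_adjacent`).  Otherwise the fan is the 2-sum
along `{a, y}` (`y` the neighbour of `x`) of the path `a – x – y` (arm `X`, R1 trivial by adjacency) and the fan over
`y :: (rest ++ [z])` (arm `Y`, R1 by induction + `r1_symm`); the FKG slacks hold for `q ≥ 1` (`fkg_slack_of_one_le`) and both
arms are non-degenerate because the parameters are positive (`real_pos_of_support`); conclude by `r1_of_apexTwoSum`.
This is KCLUSTER-gen69 THEOREM-3SUM §5 (fans, there via the M2 induction) by a different, purely structural route; with the
3-sum theorem (`ThreeSum.r1_of_threeSum_of_r1`) it gives R1-RC(q ≥ 1) on every wheel with the hub as apex (part 9).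
-/

noncomputable section

namespace Summit.CriticalPhenomena.PercolationContinuityZ3.Theorems

namespace ApexTwoSum

open Finset SimpleGraph Literature.Probability.Percolation Literature.Probability.Percolation.Gladkov
open Literature.Probability.Percolation.BHK2006 (weight)
open Literature.Probability.Percolation.DecisionTree (ind ind_of_mem ind_of_not_mem ind_nonneg)
open Literature.Probability.LatticeModels RefinedRowR3 ThreePointLB MeasureTheory
open scoped Classical

variable {V : Type*} [Fintype V]

/-- The support of the fan with apex `a` over the list `l`: all spokes `a v` (`v ∈ l`) and the rim pairs of consecutive
entries of `l` (inline notation, no definition). -/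
local notation "FS[" a ", " l "]" =>
  (List.toFinset (List.map (fun y => s(a, y)) l ++ List.zipWith (fun y y' => s(y, y')) l (List.tail l)))

/-! ### The fan support -/

section Support

variable (a : V)

omit [Fintype V] in
/-- Spokes belong to the fan support. [this work] -/
theorem spoke_mem_fan {l : List V} {y : V} (hy : y ∈ l) : s(a, y) ∈ FS[a, l] := by
  rw [List.mem_toFinset, List.mem_append, List.mem_map]
  exact Or.inl ⟨y, hy, rfl⟩

omit [Fintype V] in
/-- The fan over two vertices. [this work] -/
theorem mem_fan_pair {x y : V} {e : Sym2 V} : e ∈ FS[a, [x, y]] ↔ (e = s(a, x) ∨ e = s(a, y) ∨ e = s(x, y)) := by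
  simp only [List.map_cons, List.map_nil, List.tail_cons, List.zipWith_cons_cons, List.zipWith_nil_right,
    List.mem_toFinset, List.mem_append, List.mem_cons, List.not_mem_nil, or_false]
  tauto

omit [Fintype V] in
/-- Peeling the first rim vertex: `F(a; x :: y :: r) = {a x, x y} ∪ F(a; y :: r)`. [this work] -/
theorem mem_fan_cons_cons {x y : V} {r : List V} {e : Sym2 V} :
    e ∈ FS[a, x :: y :: r] ↔ ((e = s(a, x) ∨ e = s(x, y)) ∨ e ∈ FS[a, y :: r]) := by
  simp only [List.map_cons, List.tail_cons, List.zipWith_cons_cons, List.mem_toFinset, List.mem_append,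
    List.mem_cons]
  tauto

omit [Fintype V] in
/-- Every vertex on a pair of the fan support is the apex or a rim vertex. [this work] -/
theorem verts_fan : ∀ (l : List V), ∀ e ∈ FS[a, l], ∀ v ∈ e, v = a ∨ v ∈ l := by
  intro l
  induction l with
  | nil =>
    intro e he
    simp only [List.map_nil, List.tail_nil, List.zipWith_nil_left, List.append_nil, List.toFinset_nil,
      Finset.notMem_empty] at he
  | cons y r ih =>
    cases r with
    | nil =>
      intro e he v hv
      simp only [List.map_cons, List.map_nil, List.tail_cons, List.zipWith_nil_right, List.append_nil,
        List.toFinset_cons, List.toFinset_nil, Finset.insert_empty, Finset.mem_singleton] at he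
      subst he
      rcases Sym2.mem_iff.1 hv with rfl | rfl
      · exact Or.inl rfl
      · exact Or.inr (List.mem_cons_self)
    | cons y' r' =>
      intro e he v hv
      rcases (mem_fan_cons_cons a).1 he with (rfl | rfl) | he'
      · rcases Sym2.mem_iff.1 hv with rfl | rfl
        · exact Or.inl rfl
        · exact Or.inr List.mem_cons_self
      · rcases Sym2.mem_iff.1 hv with rfl | rfl
        · exact Or.inr List.mem_cons_self
        · exact Or.inr (List.mem_cons_of_mem _ List.mem_cons_self)
      · rcases ih e he' v hv with h1 | h1
        · exact Or.inl h1
        · exact Or.inr (List.mem_cons_of_mem _ h1)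

end Support

/-! ### R1 on fans -/

section Fans

variable (a : V) {q : ℝ} (hq : 1 ≤ q)
include hq

/-- **R1-RC on fans, every `q ≥ 1`** (see the module docstring): for the fan with apex `a` over the rim path
`x :: (l ++ [z])` of distinct vertices avoiding `a`, positive parameters on the fan support and zero parameters off it,
`φ(T)·φ(S) ≤ φ(U_x)·φ(U_z)` for the instance `(a; x, z)`. [this work] -/
theorem fan_r1 : ∀ (l : List V) (x z : V) (w : Sym2 V → unitInterval),
    (x :: (l ++ [z])).Nodup → a ∉ x :: (l ++ [z]) →
    (∀ e ∈ FS[a, x :: (l ++ [z])], 0 < (w e : ℝ)) →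
    (∀ e, e ∉ (↑(FS[a, x :: (l ++ [z])]) : Set (Sym2 V)) → (w e : ℝ) = 0) →
    (rcMeasureW w q ∅).real {η : BondConfig V | x ∈ cl η.toFinset a ∧ z ∈ cl η.toFinset a} *
        (rcMeasureW w q ∅).real {η : BondConfig V | x ∉ cl η.toFinset a ∧ z ∉ cl η.toFinset a ∧
          Sep (FS[a, x :: (l ++ [z])]) (cl η.toFinset a) x z} ≤
      (rcMeasureW w q ∅).real {η : BondConfig V | x ∈ cl η.toFinset a ∧ z ∉ cl η.toFinset a} *
        (rcMeasureW w q ∅).real {η : BondConfig V | x ∉ cl η.toFinset a ∧ z ∈ cl η.toFinset a} := by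
  have hq0 : 0 < q := one_pos.trans_le hq
  intro l
  induction l with
  | nil =>
    intro x z w hnd _ _ _
    -- two rim vertices: the terminals are adjacent
    have hxz : x ≠ z := by
      intro h; subst h; simp at hnd
    exact r1_of_adjacent w q _ hxz ((mem_fan_pair a).2 (Or.inr (Or.inr rfl)))
  | cons y rest ih =>
    intro x z w hnd hal hpos hoff
    -- names: the rim is `x :: y :: (rest ++ [z])`
    have hL : x :: ((y :: rest) ++ [z]) = x :: y :: (rest ++ [z]) := rfl
    rw [hL] at hnd hal hpos hoff ⊢
    -- distinctness facts
    have hx : x ∉ y :: (rest ++ [z]) := (List.nodup_cons.1 hnd).1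
    have hnd' : (y :: (rest ++ [z])).Nodup := (List.nodup_cons.1 hnd).2
    have hy : y ∉ rest ++ [z] := (List.nodup_cons.1 hnd').1
    have hzmem : z ∈ y :: (rest ++ [z]) :=
      List.mem_cons_of_mem _ (List.mem_append.2 (Or.inr (List.mem_singleton.2 rfl)))
    have hxy : x ≠ y := fun h => hx (by rw [h]; exact List.mem_cons_self)
    have hxz : x ≠ z := fun h => hx (by rw [h]; exact hzmem)
    have hyz : y ≠ z := fun h => hy (List.mem_append.2 (Or.inr (List.mem_singleton.2 h)))
    have hax : a ≠ x := fun h => hal (by rw [h]; exact List.mem_cons_self)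
    have hay : a ≠ y := fun h => hal (by rw [h]; exact List.mem_cons_of_mem _ List.mem_cons_self)
    have haz : a ≠ z := fun h => hal (by rw [h]; exact List.mem_cons_of_mem _ hzmem)
    have hal' : a ∉ y :: (rest ++ [z]) := fun h => hal (List.mem_cons_of_mem _ h)
    -- the two arms
    set DX : Finset (Sym2 V) := {s(a, x), s(x, y)} with hDX
    set DY : Finset (Sym2 V) := FS[a, y :: (rest ++ [z])] with hDY
    have hD : ∀ e, e ∈ FS[a, x :: y :: (rest ++ [z])] ↔ e ∈ DX ∨ e ∈ DY := by
      intro e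
      rw [mem_fan_cons_cons, hDX, Finset.mem_insert, Finset.mem_singleton]
    have vertsY := verts_fan a (y :: (rest ++ [z]))
    have hsepD : ∀ v : V, (∃ e ∈ DX, v ∈ e) → (∃ e ∈ DY, v ∈ e) → (v = a ∨ v = y) := by
      rintro v ⟨e, he, hve⟩ ⟨e', he', hve'⟩
      rcases vertsY e' he' v hve' with h1 | h1
      · exact Or.inl h1
      · rw [hDX, Finset.mem_insert, Finset.mem_singleton] at he
        rcases he with rfl | rfl
        · rcases Sym2.mem_iff.1 hve with rfl | rfl
          · exact Or.inl rfl
          · exact absurd h1 hx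
        · rcases Sym2.mem_iff.1 hve with rfl | rfl
          · exact absurd h1 hx
          · exact Or.inr rfl
    have hbY : ∀ e ∈ DY, x ∉ e := fun e he hxe => by
      rcases vertsY e he x hxe with h1 | h1
      · exact hax h1.symm
      · exact hx h1
    have hcX : ∀ e ∈ DX, z ∉ e := fun e he hze => by
      rw [hDX, Finset.mem_insert, Finset.mem_singleton] at he
      rcases he with rfl | rfl
      · rcases Sym2.mem_iff.1 hze with h1 | h1
        · exact haz h1.symm
        · exact hxz h1.symm
      · rcases Sym2.mem_iff.1 hze with h1 | h1
        · exact hxz h1.symm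
        · exact hyz h1.symm
    have hdisj : ∀ e ∈ DY, e ∉ DX := fun e he heX => by
      rw [hDX, Finset.mem_insert, Finset.mem_singleton] at heX
      rcases heX with rfl | rfl
      · exact hbY _ he (Sym2.mem_mk_right a x)
      · exact hbY _ he (Sym2.mem_mk_left x y)
    -- the arm parameters
    set wX : Sym2 V → unitInterval := fun e => if e ∈ (↑DX : Set (Sym2 V)) then w e else 0 with hwX
    set wY : Sym2 V → unitInterval := fun e => if e ∈ (↑DX : Set (Sym2 V)) then 0 else w e with hwY
    have hX : ∀ e ∈ (↑DX : Set (Sym2 V)), wX e = w e := fun e he => by simp only [hwX, if_pos he]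
    have hX' : ∀ e ∉ (↑DX : Set (Sym2 V)), wX e = 0 := fun e he => by simp only [hwX, if_neg he]
    have hY : ∀ e ∈ (↑DX : Set (Sym2 V)), wY e = 0 := fun e he => by simp only [hwY, if_pos he]
    have hY' : ∀ e ∉ (↑DX : Set (Sym2 V)), wY e = w e := fun e he => by simp only [hwY, if_neg he]
    have hw : ∀ e, e ∉ (↑DX ∪ ↑DY : Set (Sym2 V)) → (w e : ℝ) = 0 := fun e he =>
      hoff e (fun he' => he (by
        rw [Finset.mem_coe] at he'
        rcases (hD e).1 he' with h1 | h1
        · exact Or.inl h1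
        · exact Or.inr h1))
    have hposX : ∀ e ∈ DX, 0 < (wX e : ℝ) := fun e he => by
      rw [hX e (Finset.mem_coe.2 he)]
      exact hpos e ((hD e).2 (Or.inl he))
    have hoffX : ∀ e ∉ (↑DX : Set (Sym2 V)), (wX e : ℝ) = 0 := fun e he => by rw [hX' e he]; rfl
    have hposY : ∀ e ∈ DY, 0 < (wY e : ℝ) := fun e he => by
      rw [hY' e (fun he' => hdisj e he (Finset.mem_coe.1 he'))]
      exact hpos e ((hD e).2 (Or.inr he))
    have hoffY : ∀ e ∉ (↑DY : Set (Sym2 V)), (wY e : ℝ) = 0 := fun e he => by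
      by_cases heX : e ∈ (↑DX : Set (Sym2 V))
      · rw [hY e heX]; rfl
      · rw [hY' e heX]
        exact hoff e (fun he' => by
          rw [Finset.mem_coe] at he'
          rcases (hD e).1 he' with h1 | h1
          · exact heX (Finset.mem_coe.2 h1)
          · exact he (Finset.mem_coe.2 h1))
    -- arm X: the path `a – x – y`
    have hxyX : s(x, y) ∈ DX := by rw [hDX]; simp
    have haxX : s(a, x) ∈ DX := by rw [hDX]; simp
    have hR1X := r1_of_adjacent (a := a) wX q DX hxy hxyX
    have hFX := fkg_slack_of_one_le (a := a) (h := y) (t := x) wX hq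
    have hAX : (rcMeasureW wX q ∅).real {η : BondConfig V | x ∈ cl η.toFinset a ∧ y ∈ cl η.toFinset a} ≠ 0 :=
      ne_of_gt (real_pos_of_support wX hq0 DX hposX hoffX
        ⟨cl_coe_step DX (cl_coe_self DX a) haxX hax,
         cl_coe_step DX (cl_coe_step DX (cl_coe_self DX a) haxX hax) hxyX hxy⟩)
    -- arm Y: the fan over `y :: (rest ++ [z])`, by induction
    have hR1Y' := ih y z wY hnd' hal' hposY hoffY
    have hR1Y := r1_symm (a := a) wY q DY hR1Y'
    have hFY := fkg_slack_of_one_le (a := a) (h := y) (t := z) wY hq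
    have hAY : (rcMeasureW wY q ∅).real {η : BondConfig V | z ∈ cl η.toFinset a ∧ y ∈ cl η.toFinset a} ≠ 0 :=
      ne_of_gt (real_pos_of_support wY hq0 DY hposY hoffY
        ⟨cl_coe_step DY (cl_coe_self DY a) (spoke_mem_fan a hzmem) haz,
         cl_coe_step DY (cl_coe_self DY a) (spoke_mem_fan a List.mem_cons_self) hay⟩)
    -- glue
    exact r1_of_apexTwoSum hay hax haz hxz (Ne.symm hxy) hyz hsepD hbY hcX hD w wX wY hq0 hw hX hX' hY hY'
      hR1X hFX hAX hR1Y hFY hAY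

end Fans

end ApexTwoSum

end Summit.CriticalPhenomena.PercolationContinuityZ3.Theorems
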